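import Literature.IUT.HodgeTheaters.GlobalFrobenioidsPushCarrierGaloisRich
import Literature.AlgebraicGeometry.Frobenioids.ModelFrobenioidUnits
import HarnessLib

/-!
# [IUTchI] Ex 5.1 (iii) / Cor 5.3 (i) «resp. ⊚»: vertical torsion automorphisms of `†ℱ^⊚` — an invariant of equivalences over the base

S. Mochizuki, *Inter-universal Teichmüller theory I*, kurims manuscript (May 2020), §5 Example 5.1 (iii) pp. 125–126 (`†ℱ^⊚ :=
†ℱ^⊛|_{†𝒟^⊚}`), Cor 5.3 (i) p. 144 l. 2–11 («`Isom(¹ℱ^⊚, ²ℱ^⊚) → Isom(Base(¹ℱ^⊚), Base(²ℱ^⊚))` is bijective») ([IUTchI] Cor 5.3 (i) p.144)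
[claim: Mochizuki2012, status: disputed] (D-0012 claim key; nothing of the series is asserted; no side taken on [IUTchIII] Cor. 3.12);
[FrdI] Def 1.2 (ii) `O^×(A)`, Thm 5.2 (i)(ii) pp. 100–101, §0 p. 17 [cite: MochizukiFrdI2008, Thm. 5.2(ii) p.101]; [FrdII] Ex 1.3 (ii) p. 11
(`φ_*`) [cite: MochizukiFrdII2008, Ex 1.3 (ii) p.11].  PROOF-ONLY plumbing (cell abc-iut, seat abc-iut-L5-t4 gen 12, row «HLIFT⊚-FALSE@PR1»,
abc-iut-L5-lead RULINGS #238; 0 def · 0 instance · no Prop fact) for the sibling NV file `Cor53iFcircNotLiftsAllAtFstCarrier.lean`.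
The observable «`Y` has a VERTICAL automorphism `a` (`p(a) = id`) with `aⁿ = 1`, `a ≠ 1`»: §1 moves forward along any faithful `Ψ` with
`Ψ ⋙ p₂ ≅ p₁ ⋙ T` (an equivalence LYING OVER a base equivalence `Θ` is `T = Θ`) and back when `Ψ` is full and `T` faithful; §2 on the
[FrdI] §0 categorical fibre product (the tree's `CFP`, typing `†ℱ^⊚ := †ℱ^⊛ ×_{Base(†ℱ^⊛)} †𝒟^⊚`) `proj₂`-vertical = `Φ₁`-vertical on the
first component; §3 for a record `𝓕` ([IUTchI] Ex 5.1 (iii)) `𝓕.cat` over `𝓕.toBase` = the MODEL `ℱ^⊛(†𝒟^⊚)` over `†𝒟^⊛` at `𝓕.equiv`;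
§4 in a model Frobenioid ([FrdI] Thm 5.2 (i), `Φ(A_D)` integral) vertical `n`-torsion `≠ id` = `u ∈ 𝔹(A_D)`, `uⁿ = 1`, `u ≠ 1`
(`Div_B u = 0`; abc-iut-L1's `ModelFrobenioid.units` / `unitsToRatFn` / `unitAut`, [FrdI] Def 1.2 (ii) `O^×(A) ↪ 𝔹(A)`), moving along base
isomorphisms; §5 the bridges `ℬ(−)⁰ ⇄ CosetCat` on push carriers and the two coset objects `(G×G)/(V×G)`, `swap^*` of it, under `(pr₁)_*`.
HONEST: bookkeeping about OUR typed carriers; nothing here bears on print's proof route; nothing asserts abc proved or refuted. -/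

noncomputable section

namespace Literature.IUT.HodgeTheaters

open CategoryTheory Opposite Literature.AlgebraicGeometry.Frobenioids Literature.AnabelianGeometry.SemiGraphs
open Literature.AlgebraicGeometry.Frobenioids.QuasiTemperoid

universe v₁ v₂ v₃ v₄ u₁ u₂ u₃ u₄ w v u

/-! ### §1 Vertical torsion automorphisms along functors over the base -/

namespace CatIsomorphism
section Transport
variable {C₁ : Type u₁} [Category.{v₁} C₁] {C₂ : Type u₂} [Category.{v₂} C₂]
  {D₁ : Type u₃} [Category.{v₃} D₁] {D₂ : Type u₄} [Category.{v₄} D₂]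

/-- **Push-forward.**  For a FAITHFUL `Ψ : C₁ → C₂` with `Ψ ⋙ p₂ ≅ p₁ ⋙ T`: a `p₁`-vertical automorphism `a` of `X` with `aⁿ = 1`,
`a ≠ 1` gives the `p₂`-vertical automorphism `Ψ(a)` of `Ψ X` with the same two properties (an equivalence `Ψ` lying over a base
equivalence `Θ` — `LiesUnder p₁ p₂ Ψ Θ` — is the case `T = Θ`). ([IUTchI] Cor 5.3 (i) p.144) [cite: MochizukiFrdI2008, §0 p.17]
[claim: Mochizuki2012, status: disputed] -/
theorem exists_vertTorsion_map (Ψ : C₁ ⥤ C₂) [Ψ.Faithful] (p₁ : C₁ ⥤ D₁) (p₂ : C₂ ⥤ D₂) (T : D₁ ⥤ D₂)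
    (h : Ψ ⋙ p₂ ≅ p₁ ⋙ T) (n : ℕ) {X : C₁}
    (hX : ∃ a : Aut X, p₁.map a.hom = 𝟙 _ ∧ a ^ n = 1 ∧ a ≠ 1) :
    ∃ b : Aut (Ψ.obj X), p₂.map b.hom = 𝟙 _ ∧ b ^ n = 1 ∧ b ≠ 1 := by
  obtain ⟨a, ha, han, ha1⟩ := hX
  refine ⟨Functor.mapAut X Ψ a, ?_, by rw [← map_pow, han, map_one], fun h1 => ha1 ?_⟩
  · have nat := h.hom.naturality a.hom
    have h2 : (p₁ ⋙ T).map a.hom = 𝟙 _ := by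
      change T.map (p₁.map a.hom) = 𝟙 _
      rw [ha, T.map_id]
    rw [h2, Category.comp_id] at nat
    exact (cancel_mono (h.hom.app X)).mp (nat.trans (Category.id_comp _).symm)
  · apply Aut.ext
    apply Ψ.map_injective
    have h2 := congrArg Iso.hom h1
    change Ψ.map a.hom = 𝟙 _ at h2
    rw [h2]
    exact (Ψ.map_id X).symm

/-- **Pull-back.**  For `Ψ : C₁ → C₂` FULL and faithful, `T` faithful, `Ψ ⋙ p₂ ≅ p₁ ⋙ T`: a `p₂`-vertical automorphism `b` of `Ψ X`
with `bⁿ = 1`, `b ≠ 1` comes from a `p₁`-vertical automorphism of `X` with the same two properties (`Ψ⁻¹(b)`).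
([IUTchI] Cor 5.3 (i) p.144) [cite: MochizukiFrdI2008, §0 p.17] [claim: Mochizuki2012, status: disputed] -/
theorem exists_vertTorsion_of_map (Ψ : C₁ ⥤ C₂) [Ψ.Full] [Ψ.Faithful] (p₁ : C₁ ⥤ D₁) (p₂ : C₂ ⥤ D₂) (T : D₁ ⥤ D₂)
    [T.Faithful] (h : Ψ ⋙ p₂ ≅ p₁ ⋙ T) (n : ℕ) {X : C₁}
    (hX : ∃ b : Aut (Ψ.obj X), p₂.map b.hom = 𝟙 _ ∧ b ^ n = 1 ∧ b ≠ 1) :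
    ∃ a : Aut X, p₁.map a.hom = 𝟙 _ ∧ a ^ n = 1 ∧ a ≠ 1 := by
  obtain ⟨b, hb, hbn, hb1⟩ := hX
  -- `a := Ψ⁻¹(b)`, with `Ψ(a) = b`
  have hφa : Functor.mapAut X Ψ (Ψ.preimageIso b) = b := Aut.ext (Ψ.map_preimage b.hom)
  have hinj : Function.Injective (Functor.mapAut X Ψ) := fun a a' haa' =>
    Aut.ext (Ψ.map_injective (congrArg Iso.hom haa'))
  refine ⟨Ψ.preimageIso b, ?_, hinj (by rw [map_pow, hφa, hbn, map_one]), fun h1 => hb1 (by rw [← hφa, h1, map_one])⟩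
  -- verticality: `T (p₁ a) ≫ h_X = h_X ≫ p₂ (Ψ a) = h_X`, so `T (p₁ a) = id`, so `p₁ a = id`
  apply T.map_injective
  have nat := h.hom.naturality (Ψ.preimageIso b).hom
  have h2 : (Ψ ⋙ p₂).map (Ψ.preimageIso b).hom = 𝟙 _ := by
    change p₂.map (Ψ.map (Ψ.preimage b.hom)) = 𝟙 _
    rw [Ψ.map_preimage, hb]
  rw [h2, Category.id_comp] at nat
  have h3 := (cancel_epi (h.hom.app X)).mp (nat.symm.trans (Category.comp_id _).symm)
  rw [T.map_id]
  exact h3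
end Transport
end CatIsomorphism

/-! ### §2 The categorical fibre product: `proj₂`-vertical = `Φ₁`-vertical on the first component ([FrdI] §0 p. 17) -/

namespace CFPVertical
variable {C₁ : Type u₁} [Category.{v₁} C₁] {C₂ : Type u₂} [Category.{v₂} C₂] {D : Type u₃} [Category.{v₃} D]
  {Φ₁ : C₁ ⥤ D} {Φ₂ : C₂ ⥤ D}

/-- For a `proj₂`-vertical automorphism `a` of `(A₁, A₂, α)` (second component `id`), the first component is `Φ₁`-vertical
(`Φ₁(a₁) ∘ α = α ∘ Φ₂(id)`). [cite: MochizukiFrdI2008, §0 p.17] -/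
theorem map_fst_eq_id_of_snd_eq_id {Y : CFP Φ₁ Φ₂} (a : Aut Y) (ha : (CFP.proj₂ Φ₁ Φ₂).map a.hom = 𝟙 _) :
    Φ₁.map a.hom.fst = 𝟙 _ := by
  have w := a.hom.w
  change a.hom.snd = 𝟙 _ at ha
  rw [ha, Φ₂.map_id, Category.comp_id] at w
  exact (cancel_mono Y.iso.hom).mp (w.trans (Category.id_comp _).symm)

/-- **`proj₂`-vertical ⟹ `Φ₁`-vertical on the first component** (with `aⁿ = 1`, `a ≠ 1` preserved: a vertical automorphism of the
fibre product is determined by its first component). [cite: MochizukiFrdI2008, §0 p.17] -/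
theorem exists_fst_of_exists (Y : CFP Φ₁ Φ₂) (n : ℕ)
    (hY : ∃ a : Aut Y, (CFP.proj₂ Φ₁ Φ₂).map a.hom = 𝟙 _ ∧ a ^ n = 1 ∧ a ≠ 1) :
    ∃ f : Aut Y.fst, Φ₁.map f.hom = 𝟙 _ ∧ f ^ n = 1 ∧ f ≠ 1 := by
  obtain ⟨a, ha, han, ha1⟩ := hY
  -- `a ↦ a₁`, the first component, as a homomorphism `Aut Y → Aut A₁`
  let φ₁ : Aut Y →* Aut Y.fst := Functor.mapAut Y (CFP.proj₁ Φ₁ Φ₂)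
  refine ⟨φ₁ a, map_fst_eq_id_of_snd_eq_id a ha, by rw [← map_pow, han, map_one], fun h1 => ha1 ?_⟩
  have hfst : a.hom.fst = 𝟙 _ := congrArg Iso.hom h1
  have hsnd : a.hom.snd = 𝟙 _ := ha
  exact Aut.ext (CFP.hom_ext hfst hsnd)

/-- **`Φ₁`-vertical on the first component ⟹ `proj₂`-vertical** (pair it with the identity of the second component).
[cite: MochizukiFrdI2008, §0 p.17] -/
theorem exists_of_exists_fst (Y : CFP Φ₁ Φ₂) (n : ℕ)
    (hY : ∃ f : Aut Y.fst, Φ₁.map f.hom = 𝟙 _ ∧ f ^ n = 1 ∧ f ≠ 1) :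
    ∃ a : Aut Y, (CFP.proj₂ Φ₁ Φ₂).map a.hom = 𝟙 _ ∧ a ^ n = 1 ∧ a ≠ 1 := by
  obtain ⟨f, hf, hfn, hf1⟩ := hY
  have hf' : Φ₁.map f.inv = 𝟙 _ := by
    have h2 : Φ₁.mapIso f = Iso.refl _ := Iso.ext hf
    exact congrArg Iso.inv h2
  -- the automorphism `(f, id)` of `Y`
  let a : Aut Y :=
    { hom := ⟨f.hom, 𝟙 _, by rw [hf, Φ₂.map_id, Category.id_comp, Category.comp_id]⟩
      inv := ⟨f.inv, 𝟙 _, by rw [hf', Φ₂.map_id, Category.id_comp, Category.comp_id]⟩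
      hom_inv_id := CFP.hom_ext f.hom_inv_id (Category.id_comp _)
      inv_hom_id := CFP.hom_ext f.inv_hom_id (Category.id_comp _) }
  let φ₁ : Aut Y →* Aut Y.fst := Functor.mapAut Y (CFP.proj₁ Φ₁ Φ₂)
  let φ₂ : Aut Y →* Aut Y.snd := Functor.mapAut Y (CFP.proj₂ Φ₁ Φ₂)
  have ha₁ : φ₁ a = f := Aut.ext rfl
  have ha₂ : φ₂ a = 1 := Aut.ext rfl
  refine ⟨a, rfl, ?_, fun h1 => hf1 (by rw [← ha₁, h1, map_one])⟩
  apply Aut.ext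
  apply CFP.hom_ext
  · change (φ₁ (a ^ n)).hom = 𝟙 _
    rw [map_pow, ha₁, hfn]
    rfl
  · change (φ₂ (a ^ n)).hom = 𝟙 _
    rw [map_pow, ha₂, one_pow]
    rfl
end CFPVertical

/-! ### §3 A global Frobenioid record: `𝓕.cat` over `𝓕.toBase` versus the model `ℱ^⊛(†𝒟^⊚)` over `†𝒟^⊛` ([IUTchI] Ex 5.1 (iii)) -/

namespace GlobalFrobenioid
variable {G : ProfiniteGrp.{u}} {Δ : GlobalDivisorData G} {Dcirc : Type (u + 1)} [Category.{u} Dcirc]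
  {toBase0 : Dcirc ⥤ BaseCat G} (𝓕 : GlobalFrobenioid Δ Dcirc toBase0)

/-- **`𝓕.toBase`-vertical torsion on `𝓕.cat` ⟹ `Base`-vertical torsion on the model at `𝓕.equiv`** (`toBase_compat :
Base(A) = Base(equiv A)`; `identify` faithful). ([IUTchI] Ex 5.1 (iii) p.125) [claim: Mochizuki2012, status: disputed] -/
theorem exists_vertTorsion_equiv (n : ℕ) {X : 𝓕.cat}
    (hX : ∃ f : Aut X, 𝓕.toBase.map f.hom = 𝟙 _ ∧ f ^ n = 1 ∧ f ≠ 1) :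
    ∃ g : Aut (𝓕.equiv.functor.obj X), Δ.modelBase.map g.hom = 𝟙 _ ∧ g ^ n = 1 ∧ g ≠ 1 := by
  obtain ⟨f, hf, hfn, hf1⟩ := hX
  refine CatIsomorphism.exists_vertTorsion_map 𝓕.equiv.functor (𝓕.toBase ⋙ 𝓕.identify.functor) Δ.modelBase (𝟭 _)
    (𝓕.toBase_compat.symm ≪≫ (Functor.rightUnitor _).symm) n ⟨f, ?_, hfn, hf1⟩
  change 𝓕.identify.functor.map (𝓕.toBase.map f.hom) = 𝟙 _
  rw [hf, CategoryTheory.Functor.map_id]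

/-- **… and conversely** (`equiv` full and faithful). ([IUTchI] Ex 5.1 (iii) p.125) [claim: Mochizuki2012, status: disputed] -/
theorem exists_vertTorsion_of_equiv (n : ℕ) {X : 𝓕.cat}
    (hX : ∃ g : Aut (𝓕.equiv.functor.obj X), Δ.modelBase.map g.hom = 𝟙 _ ∧ g ^ n = 1 ∧ g ≠ 1) :
    ∃ f : Aut X, 𝓕.toBase.map f.hom = 𝟙 _ ∧ f ^ n = 1 ∧ f ≠ 1 := by
  haveI : 𝓕.identify.functor.Faithful := inferInstance
  obtain ⟨f, hf, hfn, hf1⟩ := CatIsomorphism.exists_vertTorsion_of_map 𝓕.equiv.functor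
    (𝓕.toBase ⋙ 𝓕.identify.functor) Δ.modelBase (𝟭 _) (𝓕.toBase_compat.symm ≪≫ (Functor.rightUnitor _).symm) n hX
  refine ⟨f, 𝓕.identify.functor.map_injective ?_, hfn, hf1⟩
  rw [CategoryTheory.Functor.map_id]
  exact hf
end GlobalFrobenioid

/-! ### §4 In a model Frobenioid: vertical torsion automorphisms = torsion of `𝔹(A_D)` ([FrdI] Thm 5.2 (ii), Def 1.2 (ii) `O^×(A) ↪ 𝔹(A)`) -/

namespace ModelVertical
variable {D : Type u} [Category.{v} D] {Φ B : Dᵒᵖ ⥤ CommMonCat.{w}} {DivB : B ⟶ monoidGp Φ}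

/-- **A `Base`-vertical automorphism `g ≠ id` with `gⁿ = id` of `(A_D, α)` gives `u := u_g ∈ 𝔹(A_D)` with `uⁿ = 1`, `u ≠ 1`**
(`g ∈ O^×(A)`; `O^×(A) → 𝔹(A)` is a homomorphism, injective for `Φ(A_D)` integral — abc-iut-L1's `unitsToRatFn_injective`).
[cite: MochizukiFrdI2008, Thm. 5.2(ii) p.101] -/
theorem exists_unit_of_exists_aut (Z : ModelFrobenioid Φ B DivB) (hΦ : IsIntegral (Φ.obj (op Z.base))) (n : ℕ)
    (hZ : ∃ g : Aut Z, (ModelFrobenioid.baseFunctor Φ B DivB).map g.hom = 𝟙 _ ∧ g ^ n = 1 ∧ g ≠ 1) :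
    ∃ u : B.obj (op Z.base), u ^ n = 1 ∧ u ≠ 1 := by
  obtain ⟨g, hg, hgn, hg1⟩ := hZ
  let x : ModelFrobenioid.units Z := ⟨g, hg, (ModelFrobenioid.degFr_hom_eq_one g).1⟩
  have hxn : x ^ n = 1 := Subtype.ext hgn
  refine ⟨(ModelFrobenioid.unitsToRatFn Z x : (B.obj (op Z.base))ˣ), ?_, fun hu => hg1 ?_⟩
  · rw [← Units.val_pow_eq_pow_val, ← map_pow, hxn, map_one, Units.val_one]
  · have hx1 : x = 1 := ModelFrobenioid.unitsToRatFn_injective hΦ (Units.ext (by rw [hu, map_one, Units.val_one]))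
    exact congrArg Subtype.val hx1

/-- **Conversely, `u ∈ 𝔹(A_D)` with `Div_B u = 0`, `uⁿ = 1`, `u ≠ 1` (`n ≥ 1`) gives the `Base`-vertical automorphism
`(1, id, 0, u)` of `(A_D, α)`, `≠ id`, of order dividing `n`** (abc-iut-L1's `unitAut`; `Φ(A_D)` integral).
[cite: MochizukiFrdI2008, Thm. 5.2(ii) p.101] -/
theorem exists_aut_of_unit (Z : ModelFrobenioid Φ B DivB) (hΦ : IsIntegral (Φ.obj (op Z.base))) {n : ℕ} (hn : 0 < n)
    (u : B.obj (op Z.base)) (hdiv : divB Φ B DivB (op Z.base) u = 1) (hun : u ^ n = 1) (hu1 : u ≠ 1) :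
    ∃ g : Aut Z, (ModelFrobenioid.baseFunctor Φ B DivB).map g.hom = 𝟙 _ ∧ g ^ n = 1 ∧ g ≠ 1 := by
  have h : Algebra.GrothendieckGroup.of (1 : Φ.obj (op Z.base)) = divB Φ B DivB (op Z.base) u := by
    rw [map_one, hdiv]
  have h' : Algebra.GrothendieckGroup.of (1 : Φ.obj (op Z.base)) =
      divB Φ B DivB (op Z.base) (u ^ (n - 1)) := by
    rw [map_one, map_pow, hdiv, one_pow]
  have hu' : u ^ (n - 1) * u = 1 := by rw [← pow_succ, Nat.sub_add_cancel hn, hun]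
  let g : Aut Z := ModelFrobenioid.unitAut Z 1 1 u (u ^ (n - 1)) h h' (mul_one 1) hu'
  let x : ModelFrobenioid.units Z := ⟨g, ModelFrobenioid.unitAut_mem_units Z 1 1 u (u ^ (n - 1)) h h' (mul_one 1) hu'⟩
  have hxu : (ModelFrobenioid.unitsToRatFn Z x : B.obj (op Z.base)) = u := rfl
  refine ⟨g, rfl, ?_, fun h1 => hu1 ?_⟩
  · have hxn : x ^ n = 1 := ModelFrobenioid.unitsToRatFn_injective hΦ (Units.ext (by
      rw [map_pow, Units.val_pow_eq_pow_val, hxu, hun, map_one, Units.val_one]))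
    exact congrArg Subtype.val hxn
  · have h2 := congrArg (fun e : Aut Z => ModelFrobenioid.unit e.hom) h1
    change u = ModelFrobenioid.unit (𝟙 Z) at h2
    rw [ModelFrobenioid.unit_id] at h2
    exact h2

/-- **Torsion of `𝔹` moves along base isomorphisms**: for `i : A ≅ A'` in `D`, an element `u' ∈ 𝔹(A')` with `u'ⁿ = 1`, `u' ≠ 1`
pulls back to `𝔹(i)(u') ∈ 𝔹(A)` with the same properties. [cite: MochizukiFrdI2008, Thm. 5.2(i) p.100] -/
theorem exists_unit_of_iso {A A' : D} (i : A ≅ A') (n : ℕ) (h : ∃ u' : B.obj (op A'), u' ^ n = 1 ∧ u' ≠ 1) :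
    ∃ u : B.obj (op A), u ^ n = 1 ∧ u ≠ 1 := by
  obtain ⟨u', hn', h1'⟩ := h
  refine ⟨(B.map i.hom.op).hom u', by rw [← map_pow, hn', map_one], fun h1 => h1' ?_⟩
  have h2 := congrArg (B.map i.inv.op).hom h1
  rw [map_one, ← CommMonCat.comp_apply, ← B.map_comp, ← op_comp, i.inv_hom_id, op_id, B.map_id,
    CommMonCat.id_apply] at h2
  exact h2

/-- **… together with the condition `Div_B = 0`** (naturality of `Div_B : 𝔹 → Φ^gp`, abc-iut-L1's `of_map_eq_divB_map`).
[cite: MochizukiFrdI2008, Thm. 5.2(i) p.100] -/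
theorem exists_unit_div_of_iso {A A' : D} (i : A ≅ A') (n : ℕ)
    (h : ∃ u' : B.obj (op A'), divB Φ B DivB (op A') u' = 1 ∧ u' ^ n = 1 ∧ u' ≠ 1) :
    ∃ u : B.obj (op A), divB Φ B DivB (op A) u = 1 ∧ u ^ n = 1 ∧ u ≠ 1 := by
  obtain ⟨u', hd', hn', h1'⟩ := h
  refine ⟨(B.map i.hom.op).hom u', ?_, by rw [← map_pow, hn', map_one], fun h2 => h1' ?_⟩
  · have h3 := ModelFrobenioid.of_map_eq_divB_map (Φ := Φ) (B := B) (DivB := DivB) i.hom (d := 1) (u := u')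
      (by rw [map_one, hd'])
    rw [map_one, map_one] at h3
    exact h3.symm
  · have h3 := congrArg (B.map i.inv.op).hom h2
    rw [map_one, ← CommMonCat.comp_apply, ← B.map_comp, ← op_comp, i.inv_hom_id, op_id, B.map_id,
      CommMonCat.id_apply] at h3
    exact h3
end ModelVertical

/-! ### §5 Coset-level plumbing for push carriers: `toBase0 (cosetToBase W) ≅ cosetToBase (ι_* W)`; the two coset objects at `pr₁` -/

section Carrier
variable (F : Type) [Field F] [NumberField F] (H : ProfiniteGrp.{0}) (ι : H →* GalFbar F) (ho : IsOpenMap ι)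

/-- **`toBase0` on a coset object**: `(baseToCoset H ⋙ ι_* ⋙ cosetToBase G_F)(cosetToBase H (H/W)) ≅ cosetToBase G_F (ι_*(H/W))` (the bridges
`ℬ(−)⁰ ⇄ CosetCat` are mutually inverse up to isomorphism). ([IUTchI] Ex 5.1 (i) p.123) [cite: MochizukiFrdII2008, Ex 1.3 (ii) p.11] -/
theorem PushCarrier.nonempty_toBase0_cosetToBase_iso (W : CosetCat H) :
    Nonempty ((baseToCoset H ⋙ CosetCat.push ι ho ⋙ cosetToBase (absGalGrp F)).obj ((cosetToBase H).obj W) ≅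
      (cosetToBase (absGalGrp F)).obj ((CosetCat.push ι ho).obj W)) := by
  haveI := BCat.connectedToBTemp_isEquivalence H
  have hT : IsTempered H := IsTempered.of_profinite
  -- `baseToCoset H (cosetToBase H W) ≅ W`
  let j : (baseToCoset H).obj ((cosetToBase H).obj W) ≅ W :=
    (CosetCat.equivConnectedPart hT).inverse.mapIso
        ((BCat.connectedToBTemp H).asEquivalence.counitIso.app ((CosetCat.toConnected hT).obj W)) ≪≫
      ((CosetCat.equivConnectedPart hT).unitIso.app W).symm
  exact ⟨(CosetCat.push ι ho ⋙ cosetToBase (absGalGrp F)).mapIso j⟩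

variable {G : Type} [Group G] [TopologicalSpace G]

/-- `pr₁ (V × G) = V`: `(pr₁)_* ((G×G)/(V×G)) = G/V`. [cite: MochizukiFrdII2008, Ex 1.3 (ii) p.11] -/
theorem CosetCatFst.push_fst_prod_top (V : OpenSubgroup G) :
    (CosetCat.push (MonoidHom.fst G G) isOpenMap_fst).obj ⟨V.prod ⊤⟩ = ⟨V⟩ := by
  apply CosetCat.ext
  ext g
  rw [show ((CosetCat.push (MonoidHom.fst G G) isOpenMap_fst).obj ⟨V.prod ⊤⟩).sg =
    CosetCat.mapOpen (MonoidHom.fst G G) isOpenMap_fst (V.prod ⊤) from rfl, CosetCat.mem_mapOpen]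
  constructor
  · rintro ⟨π, hπ, rfl⟩
    exact (Subgroup.mem_prod.mp hπ).1
  · intro hg
    exact ⟨(g, 1), Subgroup.mem_prod.mpr ⟨hg, Subgroup.mem_top _⟩, rfl⟩

/-- `pr₁ (swap⁻¹ (V × G)) = pr₁ (G × V) = G`: `(pr₁)_* (swap^* ((G×G)/(V×G))) = G/G`. [cite: MochizukiFrdII2008, Ex 1.3 (ii) p.11] -/
theorem CosetCatFst.push_fst_pull_swap_prod_top [IsTopologicalGroup G] (V : OpenSubgroup G) (ψ : G × G ≃ₜ* G × G)
    (hψ : ∀ x : G × G, ψ x = x.swap) :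
    (CosetCat.push (MonoidHom.fst G G) isOpenMap_fst).obj
        ((CosetCat.pull ψ.toMonoidHom ψ.continuous ψ.surjective).obj ⟨V.prod ⊤⟩) = CosetCat.top := by
  apply CosetCat.ext
  ext g
  rw [show ((CosetCat.push (MonoidHom.fst G G) isOpenMap_fst).obj
      ((CosetCat.pull ψ.toMonoidHom ψ.continuous ψ.surjective).obj ⟨V.prod ⊤⟩)).sg =
    CosetCat.mapOpen (MonoidHom.fst G G) isOpenMap_fst ((V.prod ⊤).comap ψ.toMonoidHom ψ.continuous) from rfl,
    CosetCat.mem_mapOpen]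
  refine ⟨fun _ => OpenSubgroup.mem_top g, fun _ => ⟨(g, 1), ?_, rfl⟩⟩
  have hmem : ψ (g, 1) ∈ (V.prod ⊤ : OpenSubgroup (G × G)) := by
    rw [hψ]
    exact ⟨V.one_mem, OpenSubgroup.mem_top g⟩
  exact hmem
end Carrier

end Literature.IUT.HodgeTheaters

end
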